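import Summits.Ventures.HSemireg.Mod4CarrierMiddleDegree
import Summits.Ventures.HSemireg.WedgeWeilMirror

/-!
# Venture HSemireg — MOD-4 line: THEOREM R_f's UPPER side degrees (`n + 1 ≤ k ≤ 2n − 1`) ON THE p4 CARRIER
# (`dim S_k + 2C(n,k′)·r_{k′} = 2C(2n,k′) + C(2n,k′)·r_{k′}`, `k + k′ = 2n` — palindromy, transported)

HONEST FRAMING. Part of the Lean index of the computation cell `pub-hsemireg` (widening group W3, seat w3-mod4-1 gen 6; file of
record `HOME/widen/W3/MOD4-OFFSPLIT-w3mod4.md` §11.1 / §12).  Finite-dimensional exterior algebra over a field ONLY (p4's carrier of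
Weil type `(n,n)`, th-7's wedge model): no abelian variety, no sheaf, no Ext group, no semiregularity map; nothing here says that HC,
HC_CM or HC_AV holds; no Literature fact is declared or used.  WHAT IS PROVED (proof-only, one theorem): th-7's palindromic clause
`Wedge.WeilPurity.weilRank_nn_deg_dual` (model, degrees `k ≥ n + 1`) TRANSPORTED to p4's carrier by seat g6's exact transport
`Mod4Carrier.finrank_S_eq_model_nn`: for every field, every `n`, every `q`, `a, b ≠ 0`, `1 ≤ k′ ≤ n − 1`, `k + k′ = 2n`:
**`dim S_k(Ecl q (2n) + a·w₊ + b·w₋) + 2·C(n,k′)·r_{k′} = 2·C(2n,k′) + C(2n,k′)·r_{k′}`** (`r_{k′} = rank H_{k′}(q)`), i.e.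
`R_{2n−k′} = R_{k′} = (r_{k′} + 2)C(2n,k′) − 2r_{k′}C(n,k′)` — so with p4's `WeilCarrier.finrank_S_weil_nn_deg` (lower side degrees) and
seat g6's `finrank_S_weil_nn_middle_of_top` (middle degree) THEOREM R_f is on the carrier IN EVERY DEGREE `1 ≤ k ≤ 2n − 1`.
All statements and proofs: w3-mod4-1 g6 (2026-08-23).  Namespace `Summit.Ventures.HSemireg.Mod4Carrier`.
References: [BuchweitzFlenner2008HH] Prop. 6.4.4 (why these operators); [BourbakiAlgebre1a3] Ch. III §11 no. 9.
-/

open Module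

namespace Summit.Ventures.HSemireg.Mod4Carrier

open Summit.Ventures.HSemireg.WedgeBridge Summit.Ventures.HSemireg.WeilCarrier
open Summit.Ventures.HSemireg.Wedge.Hankel Summit.Ventures.HSemireg.Wedge.WeilPurity

variable {K : Type*} [Field K] {n : ℕ} {V : Type*} [AddCommGroup V] [Module K V] (bV : Basis (Fin ((n + n) + (n + n))) K V)

/-- **THEOREM R_f, UPPER SIDE DEGREES, ON THE p4 CARRIER** (`1 ≤ k′`, `k′ + 1 ≤ n`, `k + k′ = 2n`, `a, b ≠ 0`, every `q`, every field):
`dim S_k(Ecl q (2n) + a·w₊ + b·w₋) + (C(n,k′) + C(n,k′))·r_{k′} = C(2n,k′) + C(2n,k′) + C(2n,k′)·r_{k′}` — th-7's `weilRank_nn_deg_dual`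
transported exactly. [cite: BuchweitzFlenner2008HH, Prop. 6.4.4] [cite: BourbakiAlgebre1a3, Ch. III §11 no. 9] -/
theorem finrank_S_weil_nn_deg_dual {k k' : ℕ} (hk1 : 1 ≤ k') (hkn : k' + 1 ≤ n) (hkk : k + k' = n + n) (q : ℕ → K) {a b : K}
    (ha : a ≠ 0) (hb : b ≠ 0) :
    Module.finrank K (S K (Lsp bV) k (Ecl bV q (n + n) + a • wUp bV n + b • wLow bV n)) +
        (n.choose k' + n.choose k') * (hankel1 K (n + n) k' q).rank =
      (n + n).choose k' + (n + n).choose k' + (n + n).choose k' * (hankel1 K (n + n) k' q).rank := by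
  have ha' : (-1 : K) ^ (n * n) * a ≠ 0 := mul_ne_zero (pow_ne_zero _ (neg_ne_zero.mpr one_ne_zero)) ha
  rw [finrank_S_eq_model_nn]
  exact weilRank_nn_deg_dual K n hk1 hkn hkk q ha' hb

/-- the same in the closed form `R_{2n−k′} = (r_{k′} + 2)·C(2n,k′) − 2·r_{k′}·C(n,k′)` (as a sum identity over `ℕ`). -/
theorem finrank_S_weil_nn_deg_dual' {k k' : ℕ} (hk1 : 1 ≤ k') (hkn : k' + 1 ≤ n) (hkk : k + k' = n + n) (q : ℕ → K) {a b : K}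
    (ha : a ≠ 0) (hb : b ≠ 0) :
    Module.finrank K (S K (Lsp bV) k (Ecl bV q (n + n) + a • wUp bV n + b • wLow bV n)) +
        2 * (hankel1 K (n + n) k' q).rank * n.choose k' =
      ((hankel1 K (n + n) k' q).rank + 2) * (n + n).choose k' := by
  have h := finrank_S_weil_nn_deg_dual bV hk1 hkn hkk q ha hb
  linarith [h]

end Summit.Ventures.HSemireg.Mod4Carrier
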